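import Summits.QuantumFields.YangMills.Theorems.BalabanLadderIRTwistedSlabTreeLevelUniform
import Summits.QuantumFields.YangMills.Theorems.BalabanLadderIRTwistedSlabSpectralPurityTwoTimes
import HarnessLib

/-!
# T1 FOR `SU(N)` WITH `L`-UNIFORM CONSTANTS AND AN `L`-DEPENDENT COUPLING THRESHOLD:
# `∃ (ℓ₀, c, C) ∀ L ∃ β₀(L) ∀ β ≥ β₀(L) ∀ t ≥ 1, projSlabDefect ≤ C·L·e^{−ct}` — everything in T1 except the order of `∃ β₀` and `∀ L`

HELPER toward stub **T1** `TwistedSlabAnchor` of LINE `twisted-slab-continuity` (crux `IRcof`, stmt-QuantumFields-26930, census row 43;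
LEAD prover ym-ir-line-tsc-p1 g5; `--supports` the crux, `--as helper`).  Theorems only.  K38 of the T1 programme, assembling
K36 (`twistedSlabAnchor_treeLevel_uniform`: the classical limit obeys `D_∞(L,t) ≤ C·L·e^{−ct}` with `c, C` independent of `L, t`), K37
(`SpectralPurity.defect_le_of_two_times`: excited weight from an early time, RATE from a late time) and K35 (`exists_spectralData_projSlabZ`):
* ★ `projSlabDefect_le_of_two_times` — two-time purity propagation ON THE LATTICE (every compact `G`, continuous unitary `ρ`, `β ≥ 0`, central `z`,
  `z^n = 1`): `projSlabDefect(t₁) ≤ δ₁ < 1∕2`, `projSlabDefect(t₂) ≤ δ₂ < 1∕2` ⇒ `∀ t ≥ t₁, projSlabDefect(t) ≤ 2(δ₁∕(1−δ₁))·((δ₂∕(1−δ₂))^{1∕t₂})^{t−t₁}`;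
* ★★★★ `twistedSlabAnchor_su_threshold` — for `N ≥ 2`, `k` a unit, `z = ω^k·1`, `z^n = 1`, `n ≥ 1`, every `ℓ₀ = m+1`: there are `c > 0`, `C ≥ 0`
  depending on `N, m` ONLY such that for every `L = m₂ + 1` there is `β₀ = β₀(L)` with
  `projSlabDefect(fund; β, z, n, ℓ₀, L, t) ≤ C·L·e^{−ct}` for ALL `β ≥ β₀` and ALL `t ≥ 1`.
  (Early time `t₁ ≈ c⁻¹log(8KL)` pins the excited weight below `1∕3`; late time `t₂ ≈ 2c⁻¹log(4KL)` pins every eigenvalue ratio below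
  `e^{−c∕2}`; `β₀(L)` = the coupling beyond which THE NUMBER's two limits at `t₁(L)`, `t₂(L)` are attained within the slack.)

HONEST FRAMING: relative to T1 (`∃ ℓ₀ β₀ c C ∀ β ≥ β₀ ∀ L ∀ t`) EXACTLY ONE thing is missing: the threshold `β₀` here depends on `L` (no rate of
convergence in `β` of the Laplace asymptotics, let alone one uniform in the box, is proved) — that uniformity IS the cluster-expansion
content M4, not in print; T1 0∕1; IRcof ∕ IR 0∕1; the Yang–Mills mass gap (Clay) is NOT proved; R4 = `BalabanLadder.UV` only.
References: G. 't Hooft, NPB 153 (1979) §5; M. García Pérez, A. González-Arroyo, M. Okawa, IJMPA 29 (2014) 1445001 §3.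
-/

set_option autoImplicit false

noncomputable section

open scoped BigOperators Topology
open Finset Filter
open Literature.MathematicalPhysics.QuantumFieldTheory Literature.MathematicalPhysics.QuantumLattice

namespace Summit.QuantumFields.YangMills.Cruxes.IRcof.TwistedSlab

/-! ## §1 Two-time purity propagation on the lattice -/

section Lattice

variable {G : Type*} [Group G] [TopologicalSpace G] [IsTopologicalGroup G] [CompactSpace G]
  [MeasurableSpace G] [BorelSpace G] [SecondCountableTopology G] {N : ℕ} {ρ : G →* Matrix (Fin N) (Fin N) ℂ}

/-- ★ **Two-time purity propagation on the lattice** (`β ≥ 0`, continuous unitary `ρ`, central `z`, `z ^ n = 1`, `n ≥ 1`, any box): if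
`projSlabDefect(t₁) ≤ δ₁ < 1∕2` and `projSlabDefect(t₂) ≤ δ₂` with `0 ≤ δ₂ < 1∕2` (`t₁, t₂ ≥ 2`), then for every `t ≥ t₁`,
`projSlabDefect(t) ≤ 2(δ₁∕(1−δ₁))·((δ₂∕(1−δ₂))^{1∕t₂})^{t−t₁}` — at the SAME `β`, constants from `(δ₁, δ₂, t₁, t₂)` only (K35 spectral
representation + K37). [cite: tHooft1979Flux, §5 (5.1)] -/
theorem projSlabDefect_le_of_two_times (hρ : Continuous ρ) (hρu : ∀ g, ρ g ∈ Matrix.unitaryGroup (Fin N) ℂ)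
    {β : ℝ} (hβ : 0 ≤ β) {z : G} (hz : z ∈ Subgroup.center G) {n : ℕ} (hn : 0 < n) (hzn : z ^ n = 1) (ℓ L : ℕ)
    {t₁ t₂ : ℕ} (ht₁ : 2 ≤ t₁) (ht₂ : 2 ≤ t₂) {δ₁ δ₂ : ℝ} (hδ₁ : δ₁ < 1 / 2) (hδ₂0 : 0 ≤ δ₂) (hδ₂ : δ₂ < 1 / 2)
    (hD₁ : projSlabDefect ρ β z n ℓ L t₁ ≤ δ₁) (hD₂ : projSlabDefect ρ β z n ℓ L t₂ ≤ δ₂) :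
    ∀ t, t₁ ≤ t → projSlabDefect ρ β z n ℓ L t ≤ 2 * (δ₁ / (1 - δ₁)) * ((δ₂ / (1 - δ₂)) ^ (1 / (t₂ : ℝ))) ^ (t - t₁) := by
  obtain ⟨m, rfl⟩ : ∃ m, n = m + 1 := ⟨n - 1, by omega⟩
  obtain ⟨s, ν, hν, -, hsum⟩ := exists_spectralData_projSlabZ hρ hρu hβ hz hzn ℓ L
  have hZ : ∀ t, 2 ≤ t → HasSum (fun j => ν j ^ t) (projSlabZ ρ β z (m + 1) ℓ L t) := fun t ht => by
    obtain ⟨M, rfl⟩ : ∃ M, t = M + 2 := ⟨t - 2, by omega⟩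
    exact hsum M
  have hpos : 0 < projSlabZ ρ β z (m + 1) ℓ L t₁ := projSlabZ_pos ρ hρ β z (Nat.succ_pos m) ℓ L t₁
  obtain ⟨-, -, hmain⟩ := SpectralPurity.defect_le_of_two_times (Z := fun t => projSlabZ ρ β z (m + 1) ℓ L t)
    (t₀ := 2) hν hZ ht₁ (by omega) ht₂ (by omega) hpos hδ₁ hδ₂0 hδ₂ hD₁ hD₂
  exact hmain

end Lattice

/-! ## §2 T1 for `SU(N)` with `L`-uniform constants and an `L`-dependent threshold -/

section Main

variable {N : ℕ} [NeZero N] {k : ZMod N}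
set_option maxHeartbeats 400000 in
/-- ★★★★ **T1 FOR `SU(N)`, UP TO THE ORDER OF `∃ β₀` AND `∀ L`.**  For `N ≥ 2`, `k` a unit (`z = ω^k·1`), `n ≥ 1` with `z^n = 1`, and every
transverse size `ℓ₀ = m + 1`: there are `c > 0` and `C ≥ 0` depending on `N, m` ONLY such that for EVERY `L = m₂ + 1` there is a threshold
`β₀ = β₀(L)` with `projSlabDefect(fund; β, z, n, ℓ₀, L, t) ≤ C·L·e^{−ct}` for ALL `β ≥ β₀` and ALL `t ≥ 1`.  Mechanism: K36 gives the classical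
limits `D_∞(L,t) ≤ C₀·L·e^{−c₀t}`; at the early time `t₁ ≈ c₀⁻¹log(8KL)` the limit is `≤ 1∕8`, at the late time `t₂ ≈ 2c₀⁻¹log(4KL)` it is
`≤ KLe^{−c₀t₂}` with `(4KLe^{−c₀t₂})^{1∕t₂} ≤ e^{−c₀∕2}`; beyond `β₀(L)` both are attained within the slack (THE NUMBER, K31d), and K37 propagates
them to all `t ≥ t₁` with rate `c₀∕2` and prefactor `(16∕3)e^{3c₀}K·L`.  HONEST: `β₀` depends on `L`; T1 (β₀ uniform in `L`) is NOT proved.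
[cite: tHooft1979Flux, §5 (5.1)–(5.4)] [cite: GarciaperezGonzalezarroyoOkawa2014, §3] -/
theorem twistedSlabAnchor_su_threshold (hN : 2 ≤ N) (hk : IsUnit k) {n : ℕ} (hn : 0 < n)
    (hzn : (suCenter N k : Matrix.specialUnitaryGroup (Fin N) ℂ) ^ n = 1) (m : ℕ) :
    ∃ c C : ℝ, 0 < c ∧ 0 ≤ C ∧ ∀ m₂ : ℕ, ∃ β₀ : ℝ, ∀ β : ℝ, β₀ ≤ β → ∀ t : ℕ, 1 ≤ t →
      projSlabDefect (fundamentalRep (Fin N)) β (suCenter N k : Matrix.specialUnitaryGroup (Fin N) ℂ) n (m + 1) (m₂ + 1) t ≤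
        C * ((m₂ + 1 : ℕ) : ℝ) * Real.exp (-(c * (t : ℝ))) := by
  obtain ⟨c, C, hc, hC0, hlim⟩ := twistedSlabAnchor_treeLevel_uniform (N := N) hN hk hn hzn m
  set K : ℝ := max C 1 with hKdef
  have hK1 : 1 ≤ K := le_max_right _ _
  have hCK : C ≤ K := le_max_left _ _
  have hK0 : 0 < K := lt_of_lt_of_le one_pos hK1
  refine ⟨c / 2, 32 / 3 * Real.exp (3 * c) * K, by positivity, by positivity, fun m₂ => ?_⟩
  set L : ℝ := ((m₂ + 1 : ℕ) : ℝ) with hLdef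
  have hL1 : 1 ≤ L := by rw [hLdef]; exact_mod_cast Nat.succ_pos m₂
  have hKL : 1 ≤ K * L := one_le_mul_of_one_le_of_one_le hK1 hL1
  have hKL0 : 0 < K * L := by positivity
  -- the early and the late time
  set x₁ : ℝ := Real.log (8 * (K * L)) / c with hx₁def
  set x₂ : ℝ := 2 * Real.log (4 * (K * L)) / c with hx₂def
  have hlog8 : 0 ≤ Real.log (8 * (K * L)) := Real.log_nonneg (by linarith)
  have hlog4 : 0 ≤ Real.log (4 * (K * L)) := Real.log_nonneg (by linarith)
  have hx₁ : 0 ≤ x₁ := div_nonneg hlog8 hc.le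
  have hx₂ : 0 ≤ x₂ := div_nonneg (by positivity) hc.le
  set t₁ : ℕ := ⌈x₁⌉₊ + 2 with ht₁def
  set t₂ : ℕ := ⌈x₂⌉₊ + 2 with ht₂def
  have ht₁2 : 2 ≤ t₁ := by omega
  have ht₂2 : 2 ≤ t₂ := by omega
  have ht₁ge : x₁ ≤ (t₁ : ℝ) := by
    rw [ht₁def]; push_cast; linarith [Nat.le_ceil x₁]
  have ht₁lt : ((t₁ : ℝ) - 1) ≤ x₁ + 2 := by
    rw [ht₁def]; push_cast; linarith [Nat.ceil_lt_add_one hx₁]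
  have ht₂ge : x₂ ≤ (t₂ : ℝ) := by
    rw [ht₂def]; push_cast; linarith [Nat.le_ceil x₂]
  -- exponential consequences
  have hct₁ : Real.log (8 * (K * L)) ≤ c * t₁ := by
    have := mul_le_mul_of_nonneg_left ht₁ge hc.le
    rwa [hx₁def, mul_div_cancel₀ _ hc.ne'] at this
  have he₁ : K * L * Real.exp (-(c * t₁)) ≤ 1 / 8 := by
    rw [Real.exp_neg]
    have h : 8 * (K * L) ≤ Real.exp (c * t₁) := by
      calc 8 * (K * L) = Real.exp (Real.log (8 * (K * L))) := (Real.exp_log (by positivity)).symm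
        _ ≤ Real.exp (c * t₁) := Real.exp_le_exp.2 hct₁
    rw [mul_inv_le_iff₀ (Real.exp_pos _)]
    linarith
  have he₁' : Real.exp (c * ((t₁ : ℝ) - 1)) ≤ 8 * (K * L) * Real.exp (2 * c) := by
    have h : c * ((t₁ : ℝ) - 1) ≤ Real.log (8 * (K * L)) + 2 * c := by
      have := mul_le_mul_of_nonneg_left ht₁lt hc.le
      rw [hx₁def, mul_add, mul_div_cancel₀ _ hc.ne'] at this
      linarith
    calc Real.exp (c * ((t₁ : ℝ) - 1)) ≤ Real.exp (Real.log (8 * (K * L)) + 2 * c) := Real.exp_le_exp.2 h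
      _ = 8 * (K * L) * Real.exp (2 * c) := by rw [Real.exp_add, Real.exp_log (by positivity)]
  have hct₂ : Real.log (4 * (K * L)) ≤ c * t₂ / 2 := by
    have := mul_le_mul_of_nonneg_left ht₂ge hc.le
    rw [hx₂def, mul_div_cancel₀ _ hc.ne'] at this
    linarith
  -- the late slack `δ₂ := 2 K L e^{−c t₂} ≤ 1/8`
  set δ₂ : ℝ := 2 * (K * L * Real.exp (-(c * t₂))) with hδ₂def
  have hδ₂pos : 0 < δ₂ := by positivity
  have hδ₂le : δ₂ ≤ 1 / 8 := by
    have h : (4 * (K * L)) ^ 2 ≤ Real.exp (c * t₂) := by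
      calc (4 * (K * L)) ^ 2 = Real.exp (2 * Real.log (4 * (K * L))) := by
            rw [← Real.rpow_natCast, Real.rpow_def_of_pos (by positivity)]; ring_nf
        _ ≤ Real.exp (c * t₂) := Real.exp_le_exp.2 (by linarith)
    rw [hδ₂def, Real.exp_neg]
    have h16 : 16 * (K * L) ≤ (4 * (K * L)) ^ 2 := by nlinarith
    have hexp : 0 < Real.exp (c * t₂) := Real.exp_pos _
    calc 2 * (K * L * (Real.exp (c * t₂))⁻¹) = 2 * (K * L) / Real.exp (c * t₂) := by ring
      _ ≤ 2 * (K * L) / (16 * (K * L)) := by gcongr; linarith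
      _ = 1 / 8 := by field_simp; ring
  have hδ₂half : δ₂ < 1 / 2 := by linarith
  -- the rate read at `t₂`: `(δ₂/(1−δ₂))^{1/t₂} ≤ e^{−c/2}`
  have hρ₂ : (δ₂ / (1 - δ₂)) ^ (1 / (t₂ : ℝ)) ≤ Real.exp (-(c / 2)) := by
    have hu0 : 0 < δ₂ / (1 - δ₂) := div_pos hδ₂pos (by linarith)
    have hu : δ₂ / (1 - δ₂) ≤ 4 * (K * L) * Real.exp (-(c * t₂)) := by
      rw [div_le_iff₀ (by linarith)]
      have : 0 ≤ K * L * Real.exp (-(c * t₂)) := by positivity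
      nlinarith
    have ht₂pos : (0 : ℝ) < t₂ := by exact_mod_cast (show 0 < t₂ by omega)
    rw [Real.rpow_def_of_pos hu0]
    refine Real.exp_le_exp.2 ?_
    have hlogu : Real.log (δ₂ / (1 - δ₂)) ≤ Real.log (4 * (K * L)) - c * t₂ := by
      calc Real.log (δ₂ / (1 - δ₂)) ≤ Real.log (4 * (K * L) * Real.exp (-(c * t₂))) := Real.log_le_log hu0 hu
        _ = Real.log (4 * (K * L)) - c * t₂ := by
            rw [Real.log_mul (by positivity) (Real.exp_pos _).ne', Real.log_exp]; ring
    have h1 : Real.log (δ₂ / (1 - δ₂)) ≤ -(c * t₂ / 2) := by linarith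
    calc Real.log (δ₂ / (1 - δ₂)) * (1 / (t₂ : ℝ)) ≤ -(c * t₂ / 2) * (1 / (t₂ : ℝ)) :=
          mul_le_mul_of_nonneg_right h1 (by positivity)
      _ = -(c / 2) := by field_simp
  have hρ₂0 : 0 ≤ (δ₂ / (1 - δ₂)) ^ (1 / (t₂ : ℝ)) := Real.rpow_nonneg (div_nonneg hδ₂pos.le (by linarith)) _
  -- the two classical limits and the threshold `β₀(L)`
  obtain ⟨D₁, hT₁, hD₁⟩ := hlim m₂ (t₁ - 1)
  obtain ⟨D₂, hT₂, hD₂⟩ := hlim m₂ (t₂ - 1)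
  have ht₁eq : t₁ - 1 + 1 = t₁ := by omega
  have ht₂eq : t₂ - 1 + 1 = t₂ := by omega
  rw [ht₁eq] at hT₁ hD₁
  rw [ht₂eq] at hT₂ hD₂
  have hD₁' : D₁ < 1 / 4 := by
    have h : C * L * Real.exp (-(c * t₁)) ≤ K * L * Real.exp (-(c * t₁)) := by gcongr
    linarith
  have hD₂' : D₂ < δ₂ := by
    have h : C * L * Real.exp (-(c * t₂)) ≤ K * L * Real.exp (-(c * t₂)) := by gcongr
    have h0 : 0 < K * L * Real.exp (-(c * t₂)) := by positivity
    linarith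
  have hev := (hT₁.eventually (Iic_mem_nhds hD₁')).and ((hT₂.eventually (Iic_mem_nhds hD₂')).and (eventually_ge_atTop (0 : ℝ)))
  obtain ⟨β₀, hβ₀⟩ := hev.exists_forall_of_atTop
  refine ⟨β₀, fun β hβ t ht => ?_⟩
  obtain ⟨h1, h2, hβ0⟩ := hβ₀ β hβ
  have hprop := projSlabDefect_le_of_two_times (continuous_fundamentalRep (n := Fin N)) fundamentalRep_mem_unitaryGroup hβ0
    (suCenter N k).2 hn hzn (m + 1) (m₂ + 1) ht₁2 ht₂2 (δ₁ := 1 / 4) (by norm_num) hδ₂pos.le hδ₂half h1 h2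
  rcases Nat.lt_or_ge t t₁ with hlt | hge
  · -- early times: the defect is `≤ 1 ≤ C' L e^{−(c/2)t}`
    have htle : (t : ℝ) ≤ (t₁ : ℝ) - 1 := by
      have h' : ((t + 1 : ℕ) : ℝ) ≤ t₁ := by exact_mod_cast hlt
      push_cast at h'; linarith
    have ha : c * (t : ℝ) ≤ c * ((t₁ : ℝ) - 1) := mul_le_mul_of_nonneg_left htle hc.le
    have hb : 0 ≤ c * (t : ℝ) := by positivity
    have hA : 1 ≤ Real.exp (-(c / 2 * (t : ℝ))) * (8 * (K * L) * Real.exp (2 * c)) := by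
      have h1 : Real.exp (-(c * ((t₁ : ℝ) - 1))) ≤ Real.exp (-(c / 2 * (t : ℝ))) := Real.exp_le_exp.2 (by linarith)
      have h2 : Real.exp (-(c * ((t₁ : ℝ) - 1))) * Real.exp (c * ((t₁ : ℝ) - 1)) = 1 := by
        rw [← Real.exp_add]; norm_num
      calc (1 : ℝ) = Real.exp (-(c * ((t₁ : ℝ) - 1))) * Real.exp (c * ((t₁ : ℝ) - 1)) := h2.symm
        _ ≤ Real.exp (-(c / 2 * (t : ℝ))) * (8 * (K * L) * Real.exp (2 * c)) := by gcongr
    have hsplit : Real.exp (3 * c) = Real.exp c * Real.exp (2 * c) := by rw [← Real.exp_add]; ring_nf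
    have hec : 1 ≤ Real.exp c := Real.one_le_exp hc.le
    calc projSlabDefect (fundamentalRep (Fin N)) β (suCenter N k : Matrix.specialUnitaryGroup (Fin N) ℂ) n (m + 1) (m₂ + 1) t ≤ 1 :=
          projSlabDefect_le_one _ β _ n _ _ t
      _ ≤ 4 / 3 * Real.exp c * 1 := by linarith
      _ ≤ 4 / 3 * Real.exp c * (Real.exp (-(c / 2 * (t : ℝ))) * (8 * (K * L) * Real.exp (2 * c))) := by gcongr
      _ = 32 / 3 * Real.exp (3 * c) * K * L * Real.exp (-(c / 2 * (t : ℝ))) := by rw [hsplit]; ring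
  · -- late times: two-time propagation
    have hmain := hprop t hge
    have hpow : ((δ₂ / (1 - δ₂)) ^ (1 / (t₂ : ℝ))) ^ (t - t₁) ≤ Real.exp (-(c / 2)) ^ (t - t₁) :=
      pow_le_pow_left₀ hρ₂0 hρ₂ _
    have hexp2 : Real.exp (-(c / 2)) ^ (t - t₁) = Real.exp (c / 2 * t₁) * Real.exp (-(c / 2 * (t : ℝ))) := by
      rw [← Real.exp_nat_mul, ← Real.exp_add, Nat.cast_sub hge]; ring_nf
    have h13 : 2 * ((1 : ℝ) / 4 / (1 - 1 / 4)) = 2 / 3 := by norm_num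
    rw [h13] at hmain
    have ht₁0 : 0 ≤ c * (t₁ : ℝ) := by positivity
    have het₁ : Real.exp (c / 2 * t₁) ≤ 8 * (K * L) * Real.exp (3 * c) := by
      calc Real.exp (c / 2 * t₁) ≤ Real.exp (c * ((t₁ : ℝ) - 1) + c) := Real.exp_le_exp.2 (by linarith)
        _ = Real.exp (c * ((t₁ : ℝ) - 1)) * Real.exp c := Real.exp_add _ _
        _ ≤ 8 * (K * L) * Real.exp (2 * c) * Real.exp c := by gcongr
        _ = 8 * (K * L) * Real.exp (3 * c) := by rw [mul_assoc, ← Real.exp_add]; ring_nf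
    have hX : 0 ≤ Real.exp (3 * c) * K * L * Real.exp (-(c / 2 * (t : ℝ))) := by positivity
    calc projSlabDefect (fundamentalRep (Fin N)) β (suCenter N k : Matrix.specialUnitaryGroup (Fin N) ℂ) n (m + 1) (m₂ + 1) t
        ≤ 2 / 3 * ((δ₂ / (1 - δ₂)) ^ (1 / (t₂ : ℝ))) ^ (t - t₁) := hmain
      _ ≤ 2 / 3 * (Real.exp (c / 2 * t₁) * Real.exp (-(c / 2 * (t : ℝ)))) := by rw [← hexp2]; gcongr
      _ ≤ 2 / 3 * (8 * (K * L) * Real.exp (3 * c) * Real.exp (-(c / 2 * (t : ℝ)))) := by gcongr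
      _ = 16 / 3 * Real.exp (3 * c) * K * L * Real.exp (-(c / 2 * (t : ℝ))) := by ring
      _ ≤ 32 / 3 * Real.exp (3 * c) * K * L * Real.exp (-(c / 2 * (t : ℝ))) := by linarith

end Main

end Summit.QuantumFields.YangMills.Cruxes.IRcof.TwistedSlab

end
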